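import Literature.AnabelianGeometry.EtaleTheta.ThetaCohomologyInversion
import Literature.AnabelianGeometry.EtaleTheta.ThetaCohomologyZHatLog
import Literature.AnabelianGeometry.EtaleTheta.Discharge.Sec2InversionFixesDeltaTheta
import Literature.AnabelianGeometry.EtaleTheta.Discharge.Sec1InversionTemperedCriterion
import Literature.AnabelianGeometry.EtaleTheta.Thm16SubdagThetaLift
import HarnessLib

/-!
# [EtTh] Prop. 1.5 (ii)+(iii): «an inversion automorphism acts by `−1` on `F̈¹/F̈² = Ẑ·log(Ü)`» — PROVED from the
# root predicates (proof-only)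

Mochizuki, *The étale theta function and its Frobenioid-theoretic manifestations*, Publ. RIMS **45** (2009), Prop. 1.5
(ii)(iii) p. 23, proof of Thm. 1.6 (iii) p. 25 [cite: MochizukiEtTh2009, Prop 1.5 (iii) p.23]. abc-iut cell, layer
L2, seat abc-iut-L2-t1 (§1 ROOT owner). PROOF-ONLY (0 `def`, 0 new `Prop`).

`ThetaSetting.InvNegatesFdd1Quot hC hι cι` (`ThetaCohomologyInversion.lean`; = the binder `hιF1` of abc-iut-L6-d5's K3
capstone) reads «the Θ-level action `T` of the inversion automorphism `ι` satisfies `T d · d ∈ F̈²` for all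
`d ∈ F̈¹`». Print obtains it from Prop. 1.5 (ii) «F̈¹/F̈² = Hom((Δ^tp_Ÿ)^ell, Δ_Θ) = Ẑ·log(Ü)» and (iii) «ι maps
log(Ü) to −log(Ü) + log(O^×)». HERE it is DERIVED, for every `ι` with `ThetaSetting.IsInversionAut D ι` and every
theta companion, from the `Ẑ`-free root typing `ThetaSetting.Prop15iiQuot E hC` (`ThetaCohomologyZHatLog.lean`) of
(ii) alone — the group theory being: `ι` acts by `−1` on `(Δ^tp_X)^ell` (`IsInversionAut.ell_apply`), hence
(abc-iut-w5-d072 / w4-d014: `Sec1InversionTemperedCriterion`, `Sec2InversionFixesDeltaTheta`) its companion `ι^Θ`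
fixes `Δ_Θ = ∧²` POINTWISE, while `λ ∘ ι^Θ = λ⁻¹` for the standard map `λ : (Δ^tp_Ÿ)^Θ/Δ_Θ ⥲ Δ_Θ`; a class
`d ∈ F̈¹` restricts on `(Δ^tp_Ÿ)^Θ` to `e ∘ λ` (`e ∈ End_cont(Δ_Θ) = Ẑ`), and `T d` to
`ι^Θ ∘ (e ∘ λ) ∘ (ι^Θ)⁻¹ = e ∘ λ⁻¹`, so `T d · d` restricts to `1`, i.e. lies in `F̈² = Ker(res)`.
* `ThetaSetting.IsInversionAut.completionAut_inversion` — (R1e′) «`ι̂` acts as `−1` on `Δ_X^ab`» from `ell_apply`;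
* `ThetaSetting.IsInversionAut.thetaIso_apply_eq_self` — `ι^Θ = id` on `Δ_Θ` (any companion);
* `ThetaSetting.IsInversionAut.lam_thetaIso_symm_mul` — `λ(ι^Θ⁻¹ w) · λ(w) = 1` on `(Δ^tp_Ÿ)^Θ`;
* `ThetaSetting.thetaTransport_mk` — the Θ-level action on a cocycle `f` is the class of `w ↦ ι^Θ(f(ι^Θ⁻¹ w))`
  (formula of abc-iut-L6-d5's `Thm16Sub.exists_thetaTransport`, re-derived as an equation);
* `ThetaSetting.IsInversionAut.invNegatesFdd1Quot` — **`Prop15iiQuot E hC → InvNegatesFdd1Quot hC hι cι`**.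
HONEST FRAMING: [EtTh] is refereed; nothing here bears on [IUTchIII] Cor. 3.12; typed ≠ proved; no side taken.
-/

noncomputable section

namespace Literature.AnabelianGeometry.EtaleTheta

open Literature.AnabelianGeometry.SemiGraphs
open scoped IsMulCommutative

namespace ThetaSetting

variable {p : ℕ} [Fact p.Prime] {D : ThetaSetting p} {ι : D.PiTemp ≃ₜ* D.PiTemp}

/-! ### (R1e′) from `IsInversionAut`, and `ι^Θ = id` on `Δ_Θ` -/

/-- **(R1e′) «`ι̂` acts as `−1` on `Δ_X^ab`» holds for an inversion automorphism**: `ι` acts by `−1` on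
`(Δ^tp_X)^ell` (`ell_apply`), i.e. `ι(x)·x ∈ Ker(Π^tp_X ↠ (Π^tp_X)^ell) = ι_X⁻¹(closure ⁅Δ_X, Δ_X⁆)` for `x ∈ Δ^tp_X`
(root field `ker_toEll`), which decides (R1e′) on the dense tempered subgroup (abc-iut-w5-d072's
`completionAut_mul_self_mem_iff`). [cite: MochizukiEtTh2009, Prop 1.5 (iii) p.23] -/
theorem IsInversionAut.completionAut_inversion (hι : D.IsInversionAut ι) :
    ∀ g ∈ D.toTemperedCurve.DeltaHat, D.toTemperedCurve.completionAut ι g * g ∈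
      (⁅D.toTemperedCurve.DeltaHat, D.toTemperedCurve.DeltaHat⁆).topologicalClosure := by
  refine (D.toTemperedCurve.completionAut_mul_self_mem_iff ι).mpr fun x hx => ?_
  have hker : ι x * x ∈ (D.thetaToEll.comp D.toTheta).ker := by
    rw [MonoidHom.mem_ker, MonoidHom.comp_apply, map_mul, map_mul, hι.ell_apply x hx, inv_mul_cancel]
  rw [D.ker_toEll, Subgroup.mem_comap] at hker
  exact hker

/-- **`ι^Θ` fixes `Δ_Θ` pointwise** for every theta companion of an inversion automorphism (abc-iut-w4-d014's
`ThetaCompanion.thetaIso_apply_eq_self_of_inversion` under (R1e′); «Δ_Θ = Im(∧² Δ^ell_X)», `(−1)·(−1) = +1`).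
[cite: MochizukiEtTh2009, Prop 1.5 (iii) p.23] -/
theorem IsInversionAut.thetaIso_apply_eq_self (hι : D.IsInversionAut ι) (cι : ThetaCompanion ι)
    {a : D.GtpTheta} (ha : a ∈ D.DeltaTheta) : cι.thetaIso.toMulEquiv a = a :=
  ThetaCompanion.thetaIso_apply_eq_self_of_inversion D hι.completionAut_inversion cι a ha

/-- `(ι^Θ)⁻¹` fixes `Δ_Θ` pointwise. [cite: MochizukiEtTh2009, Prop 1.5 (iii) p.23] -/
theorem IsInversionAut.thetaIso_symm_apply_eq_self (hι : D.IsInversionAut ι) (cι : ThetaCompanion ι)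
    {a : D.GtpTheta} (ha : a ∈ D.DeltaTheta) : cι.thetaIso.toMulEquiv.symm a = a := by
  apply cι.thetaIso.toMulEquiv.injective
  rw [MulEquiv.apply_symm_apply, hι.thetaIso_apply_eq_self cι ha]

/-! ### `ι^Θ` on `(Δ^tp_Ÿ)^Θ`: it preserves it and inverts the standard map `λ` -/

/-- `(ι^Θ)⁻¹` carries `(Δ^tp_Ÿ)^Θ` into itself. [cite: MochizukiEtTh2009, Prop 1.5 (iii) p.23] -/
theorem IsInversionAut.thetaIso_symm_mem_dtpYddTheta (hι : D.IsInversionAut ι) (cι : ThetaCompanion ι)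
    {w : D.GtpTheta} (hw : w ∈ (D.DtpYddN 1).map D.toTheta) :
    cι.thetaIso.toMulEquiv.symm w ∈ (D.DtpYddN 1).map D.toTheta := by
  obtain ⟨x, hx, rfl⟩ := hw
  refine ⟨ι.toMulEquiv.symm x, ?_, (Thm16Sub.thetaIso_symm_toTheta cι x).symm⟩
  have h1 : ι.toMulEquiv.symm x ∈ (D.GtpYddN 1).map ι.symm.toMulEquiv.toMonoidHom := ⟨x, hx.1, rfl⟩
  have h2 : ι.toMulEquiv.symm x ∈ D.DeltaTemp.map ι.symm.toMulEquiv.toMonoidHom := ⟨x, hx.2, rfl⟩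
  rw [hι.symm.map_GtpYddN] at h1
  rw [hι.symm.map_deltaTemp] at h2
  exact ⟨h1, h2⟩

/-- **`λ((ι^Θ)⁻¹ w) · λ(w) = 1` on `(Δ^tp_Ÿ)^Θ`** for the standard map `λ : (Δ^tp_Ÿ)^Θ ↠ Δ_Θ` with kernel `Δ_Θ`
(`IsStdLog`): `ι` acts by `−1` on `(Δ^tp_X)^ell`, so `(ι^Θ)⁻¹(w)·w ∈ Δ_Θ = Ker λ` — «ι acts by −1 on
(Δ^tp_Ÿ)^ell = (Δ^tp_Ÿ)^Θ/Δ_Θ». [cite: MochizukiEtTh2009, Prop 1.5 (iii) p.23] -/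
theorem IsInversionAut.lam_thetaIso_symm_mul (hι : D.IsInversionAut ι) (cι : ThetaCompanion ι)
    {lam : ↥((D.DtpYddN 1).map D.toTheta) →ₜ* D.DeltaTheta} (hlam : IsStdLog lam)
    (w : ↥((D.DtpYddN 1).map D.toTheta)) :
    lam ⟨cι.thetaIso.toMulEquiv.symm w.1, hι.thetaIso_symm_mem_dtpYddTheta cι w.2⟩ * lam w = 1 := by
  rw [← map_mul]
  apply (hlam.ker_iff _).mpr
  change cι.thetaIso.toMulEquiv.symm w.1 * w.1 ∈ D.thetaToEll.ker
  obtain ⟨x, hx, hxw⟩ := w.2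
  rw [MonoidHom.mem_ker, ← hxw, Thm16Sub.thetaIso_symm_toTheta cι x, map_mul]
  have h := hι.symm.ell_apply x hx.2
  change D.thetaToEll (D.toTheta (ι.toMulEquiv.symm x)) = (D.thetaToEll (D.toTheta x))⁻¹ at h
  rw [h, inv_mul_cancel]

/-! ### The Θ-level action on cocycles -/

/-- The Θ-level transport of a cocycle `f` on `(Π^tp_Ÿ)^Θ` along `ι`: the function `w ↦ ι^Θ(f((ι^Θ)⁻¹ w))` is a
continuous cocycle (abc-iut-L6-d5's construction in `Thm16Sub.exists_thetaTransport`, restated).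
[cite: MochizukiEtTh2009, Thm 1.6 (iii) p.25] -/
theorem thetaTransportFun_mem (hι : Thm16i ι) (cι : ThetaCompanion ι)
    (f : contCocycles (MonoidHom.id D.GtpTheta) D.DeltaTheta (D.GtpYdd.map D.toTheta)) :
    (fun w : ↥(D.GtpYdd.map D.toTheta) =>
      (⟨cι.thetaIso.toMulEquiv (f.1 ⟨cι.thetaIso.toMulEquiv.symm w.1,
          Thm16Sub.thetaIso_symm_mem_GtpYddTheta hι cι w.2⟩).1, cι.apply_mem _⟩ : D.DeltaTheta)) ∈
      contCocycles (MonoidHom.id D.GtpTheta) D.DeltaTheta (D.GtpYdd.map D.toTheta) := by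
  -- adapted from Thm16SubdagThetaTransportEquiv.exists_thetaTransport (abc-iut-L6-d5)
  set θ := cι.thetaIso.toMulEquiv with hθ
  have hθc : Continuous fun w : D.GtpTheta => θ.symm w := cι.thetaIso.continuous_invFun
  refine ⟨?_, fun u w => ?_⟩
  · apply continuous_induced_rng.2
    change Continuous fun w : ↥(D.GtpYdd.map D.toTheta) =>
      (θ (f.1 ⟨θ.symm w.1, Thm16Sub.thetaIso_symm_mem_GtpYddTheta hι cι w.2⟩).1 : D.GtpTheta)
    exact (map_continuous cι.thetaIso).comp (continuous_subtype_val.comp (f.2.1.comp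
      ((hθc.comp continuous_subtype_val).subtype_mk _)))
  · have huw : (⟨θ.symm (u * w).1, Thm16Sub.thetaIso_symm_mem_GtpYddTheta hι cι (u * w).2⟩ :
          ↥(D.GtpYdd.map D.toTheta)) =
        ⟨θ.symm u.1, Thm16Sub.thetaIso_symm_mem_GtpYddTheta hι cι u.2⟩ *
          ⟨θ.symm w.1, Thm16Sub.thetaIso_symm_mem_GtpYddTheta hι cι w.2⟩ := by
      apply Subtype.ext
      simp only [Subgroup.coe_mul, MulMemClass.mk_mul_mk, map_mul]
    apply Subtype.ext
    change θ (f.1 ⟨θ.symm (u * w).1, _⟩).1 =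
      θ (f.1 ⟨θ.symm u.1, _⟩).1 * ((MonoidHom.id D.GtpTheta) u.1 * θ (f.1 ⟨θ.symm w.1, _⟩).1 *
        ((MonoidHom.id D.GtpTheta) u.1)⁻¹)
    rw [huw, f.2.2]
    simp only [Subgroup.coe_mul, MulAut.conjNormal_apply, MonoidHom.id_apply, map_mul, map_inv,
      MulEquiv.apply_symm_apply]

/-- **The Θ-level action on a class is the class of the transported cocycle**: for ANY intertwiner `T`
(`infl ∘ T = transport ∘ infl`) and any cocycle `f`, `T [f] = [w ↦ ι^Θ(f((ι^Θ)⁻¹ w))]` (inflation is injective,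
abc-iut-L2-t12's `inflTheta_injective`). [cite: MochizukiEtTh2009, Thm 1.6 (iii) p.25] -/
theorem thetaTransport_mk (hι : Thm16i ι) (cι : ThetaCompanion ι)
    (T : D.H1Theta (D.GtpYdd.map D.toTheta) ≃* D.H1Theta (D.GtpYdd.map D.toTheta))
    (hT : ∀ z, D.inflTheta D.GtpYdd (T z) = transport cι hι (D.inflTheta D.GtpYdd z))
    (f : contCocycles (MonoidHom.id D.GtpTheta) D.DeltaTheta (D.GtpYdd.map D.toTheta)) :
    T (QuotientGroup.mk f) = ContH1.mk _ (thetaTransportFun_mem hι cι f) := by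
  apply D.inflTheta_injective D.GtpYdd
  rw [hT]
  -- adapted from Thm16SubdagThetaTransportEquiv.exists_thetaTransport (abc-iut-L6-d5)
  change QuotientGroup.mk (transportCocycle cι hι
      (ContH1.inflCocycle D.DeltaTheta D.toTheta D.continuous_toTheta le_rfl f)) =
    (QuotientGroup.mk (ContH1.inflCocycle D.DeltaTheta D.toTheta D.continuous_toTheta le_rfl
      ⟨_, thetaTransportFun_mem hι cι f⟩) : D.H1 D.GtpYdd)
  congr 1
  apply Subtype.ext
  funext y
  apply Subtype.ext
  change cι.thetaIso (f.1 ⟨D.toTheta (ι.toMulEquiv.symm y.1), _⟩).1 =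
    cι.thetaIso.toMulEquiv (f.1 ⟨cι.thetaIso.toMulEquiv.symm (D.toTheta y.1), _⟩).1
  exact congrArg (fun u : ↥(D.GtpYdd.map D.toTheta) => cι.thetaIso.toMulEquiv (f.1 u).1)
    (Subtype.ext (Thm16Sub.thetaIso_symm_toTheta cι y.1).symm)

/-! ### The main result -/

/-- On `(Δ^tp_Ÿ)^Θ` a class in `F̈¹` IS the function `e ∘ λ` given by `Prop15iiQuot` (coboundaries vanish there).
[cite: MochizukiEtTh2009, Prop 1.5 (ii) p.23] -/
theorem apply_eq_of_res_eq_homClass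
    (f : contCocycles (MonoidHom.id D.GtpTheta) D.DeltaTheta (D.GtpYdd.map D.toTheta))
    (g : ↥((D.DtpYddN 1).map D.toTheta) →ₜ* D.DeltaTheta)
    (hres : ContH1.res (MonoidHom.id D.GtpTheta) D.DeltaTheta
        (Subgroup.map_mono inf_le_left : (D.DtpYddN 1).map D.toTheta ≤ D.GtpYdd.map D.toTheta)
        (QuotientGroup.mk f) = homClass dtpYddTheta_le_deltaTheta_map g)
    (w : ↥((D.DtpYddN 1).map D.toTheta)) :
    f.1 ⟨w.1, (Subgroup.map_mono inf_le_left : (D.DtpYddN 1).map D.toTheta ≤ D.GtpYdd.map D.toTheta) w.2⟩ =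
      g w := by
  change ContH1.mk _ (ContH1.resCocycle (MonoidHom.id D.GtpTheta) D.DeltaTheta
      (Subgroup.map_mono inf_le_left : (D.DtpYddN 1).map D.toTheta ≤ D.GtpYdd.map D.toTheta) f).2 =
    ContH1.mk _ (hom_mem_contCocycles dtpYddTheta_le_deltaTheta_map g) at hres
  rw [ContH1.mk_eq_mk_iff] at hres
  obtain ⟨a, ha⟩ := hres
  have h := ha w
  rw [MonoidHom.id_apply, conjNormal_deltaTheta_eq_self (dtpYddTheta_le_deltaTheta_map w.2), mul_inv_cancel,
    inv_mul_eq_one] at h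
  exact h

/-- **«An inversion automorphism acts by `−1` on `F̈¹/F̈²`», PROVED**: for `ι` an inversion automorphism
(`IsInversionAut`) with any theta companion, `Prop15iiQuot E hC` («F̈¹/F̈² = Ẑ·log(Ü)», `Ẑ`-free) implies
`InvNegatesFdd1Quot hC hι cι` — the K3 capstone's binder `hιF1`. [cite: MochizukiEtTh2009, Prop 1.5 (iii) p.23] -/
theorem IsInversionAut.invNegatesFdd1Quot (hι : D.IsInversionAut ι) (cι : ThetaCompanion ι) {hC : D.Compat}
    {E : D.KummerData} (hquot : Prop15iiQuot E hC) : D.InvNegatesFdd1Quot hC hι cι := by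
  intro T hT d hd
  obtain ⟨lam, hstd, hspec⟩ := hquot
  obtain ⟨f, rfl⟩ := QuotientGroup.mk_surjective d
  obtain ⟨e, he⟩ := hspec.exists_endo _ hd
  have hf := apply_eq_of_res_eq_homClass f (e.comp lam) he
  rw [mem_Fdd2_iff, thetaTransport_mk hι.thm16i cι T hT f]
  change ContH1.res (MonoidHom.id D.GtpTheta) D.DeltaTheta _
      (ContH1.mk _ (thetaTransportFun_mem hι.thm16i cι f) * ContH1.mk f.1 f.2) = 1
  rw [ContH1.mk_mul_mk]
  change ContH1.mk _ (ContH1.resCocycle (MonoidHom.id D.GtpTheta) D.DeltaTheta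
      (Subgroup.map_mono inf_le_left : (D.DtpYddN 1).map D.toTheta ≤ D.GtpYdd.map D.toTheta)
      ⟨_, mul_mem (thetaTransportFun_mem hι.thm16i cι f) f.2⟩).2 = 1
  rw [ContH1.mk_eq_one_iff, mem_contCoboundaries_iff]
  refine ⟨1, funext fun w => ?_⟩
  rw [map_one, inv_one, mul_one]
  -- the value at `w ∈ (Δ^tp_Ÿ)^Θ`: `ι^Θ(f((ι^Θ)⁻¹ w)) · f(w) = e(λ((ι^Θ)⁻¹ w)) · e(λ w) = 1`
  have hw' : cι.thetaIso.toMulEquiv.symm w.1 ∈ (D.DtpYddN 1).map D.toTheta :=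
    hι.thetaIso_symm_mem_dtpYddTheta cι w.2
  have h1 := hf w
  have h2 := hf ⟨cι.thetaIso.toMulEquiv.symm w.1, hw'⟩
  apply Subtype.ext
  change cι.thetaIso.toMulEquiv (f.1 ⟨cι.thetaIso.toMulEquiv.symm w.1, _⟩).1 * (f.1 ⟨w.1, _⟩).1 = 1
  rw [h1, h2]
  rw [hι.thetaIso_apply_eq_self cι ((e.comp lam) _).2, ← Subgroup.coe_mul]
  change (((e (lam ⟨cι.thetaIso.toMulEquiv.symm w.1, hw'⟩) * e (lam w) : D.DeltaTheta)) : D.GtpTheta) = 1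
  rw [← map_mul, hι.lam_thetaIso_symm_mul cι hstd w, map_one, OneMemClass.coe_one]

end ThetaSetting

end Literature.AnabelianGeometry.EtaleTheta

end
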